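import Summits.NavierStokesRegularity.FunctionalMining.StretchingLaminateProfile
import Mathlib.Tactic.Linarith
import HarnessLib

/-!
# K1-Q1 via lamination trees: slab envelopes for the local node `LaminateStep` (Lemma E)

Cell `pub-nsfunc` (host summit NavierStokesRegularity, topic `FunctionalMining`), dictionary seat gen 9.
**Search for candidate a priori estimates; no regularity claim.** Pure one-dimensional calculus; nothing about
Navier–Stokes solutions (or about any field on `T³`) is asserted in this file.

**Lemma E of the dict blueprint `pub-nsfunc-dict/StretchingLaminateStep.BLUEPRINT.md` §1(c)** (companion of
(al) `StretchingLaminateProfile`, Lemma P): for `0 < a`, `b ≤ 1` and a width `δ > 0` the smooth `1`-periodic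
PLATEAU ENVELOPE `env a b δ` with values in `[0,1]`, `= 1` on `fract ∈ [a+δ, b−δ]`, `= 0` off `fract ∈ (a, b)`,
and (for `a + 2δ ≤ b`) `b − a − 2δ ≤ ∫₀¹ envᵖ ≤ b − a` for every `p ≥ 1` — the one-dimensional N4-type envelope
of the laminate step, `E₊ := env δ λ δ` (support inside the `+` plateau `{Φ' = 1 − λ}` of Lemma P) and
`E₋ := env (λ+δ) 1 δ` (support inside the `−` plateau `{Φ' = −λ}`); the two SUPPORT–PLATEAU COUPLINGS are the
last lemmas of the file (`stepPrimD_eq_of_envPlus_ne_zero`, `stepPrimD_eq_of_envMinus_ne_zero`). Only BOUNDS on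
the envelope integrals are ever used (blueprint §3), so nothing transcendental is computed. Construction:
`env a b δ (y) = ψ((fract y − a)/δ)·(1 − ψ((fract y − b + δ)/δ))`, `ψ = Real.smoothTransition`; smoothness by the
local-representative pattern of the tree's `DEIJ.slopeWave`. [ours; elementary]
-/

noncomputable section

open MeasureTheory Set Filter Topology Function
open scoped ContDiff

namespace Summit.NavierStokesRegularity.FunctionalMining

open Literature.Analysis Literature.Analysis.FunctionSpaces Literature.Analysis.FunctionSpaces.Torus
open Literature.Analysis.FluidPDE Literature.Analysis.FluidPDE.Torus

namespace Laminate

variable {a b δ : ℝ}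

/-! ## 1. The envelope function and its smooth representatives -/

/-- **The plateau envelope** `ψ((fract y − a)/δ)·(1 − ψ((fract y − b + δ)/δ))`. [ours; elementary] -/
def envFun (a b δ y : ℝ) : ℝ :=
  Real.smoothTransition ((Int.fract y - a) / δ) * (1 - Real.smoothTransition ((Int.fract y - b + δ) / δ))

/-- The smooth global representative of the envelope on the period `[n, n+1)`. [ours; bookkeeping] -/
def envAux (a b δ : ℝ) (n : ℤ) (z : ℝ) : ℝ :=
  Real.smoothTransition ((z - n - a) / δ) * (1 - Real.smoothTransition ((z - n - b + δ) / δ))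

/-- The envelope is `1`-periodic. [ours; elementary] -/
theorem envFun_periodic (a b δ : ℝ) : Function.Periodic (envFun a b δ) 1 := fun y => by
  simp [envFun, Int.fract_add_one]

/-- The representatives are smooth. [ours; elementary] -/
theorem contDiff_envAux (a b δ : ℝ) (n : ℤ) : ContDiff ℝ ∞ (envAux a b δ n) := by
  have h1 : ContDiff ℝ ∞ fun z : ℝ => (z - n - a) / δ :=
    ((contDiff_id.sub contDiff_const).sub contDiff_const).div_const _
  have h2 : ContDiff ℝ ∞ fun z : ℝ => (z - n - b + δ) / δ :=
    (((contDiff_id.sub contDiff_const).sub contDiff_const).add contDiff_const).div_const _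
  unfold envAux
  exact (Real.smoothTransition.contDiff.comp h1).mul
    (contDiff_const.sub (Real.smoothTransition.contDiff.comp h2))

/-- On the period containing `y` the envelope is its representative. [ours; bookkeeping] -/
theorem envFun_eq_aux {y z : ℝ} (hz : ⌊z⌋ = ⌊y⌋) : envFun a b δ z = envAux a b δ ⌊y⌋ z := by
  simp only [envFun, envAux, Int.fract, hz]

/-- Near a non-integer the envelope coincides with a smooth global function. [ours; elementary] -/
theorem envFun_eventuallyEq_aux {y : ℝ} (hy : Int.fract y ≠ 0) :
    envFun a b δ =ᶠ[𝓝 y] envAux a b δ ⌊y⌋ := by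
  have h1 : (⌊y⌋ : ℝ) < y := by
    refine lt_of_le_of_ne (Int.floor_le y) fun h => hy ?_
    rw [Int.fract, h, sub_self]
  have h2 : y < ⌊y⌋ + 1 := Int.lt_floor_add_one y
  have hfl : ∀ᶠ z in 𝓝 y, ⌊z⌋ = ⌊y⌋ := by
    filter_upwards [Ioo_mem_nhds h1 h2] with z hz
    exact Int.floor_eq_iff.2 ⟨hz.1.le, hz.2⟩
  exact hfl.mono fun z hz => envFun_eq_aux hz

/-- Near an integer `n` the envelope coincides with the representative of the PREVIOUS period `[n−1, n)`:
to the right of `n` (inside `fract < a`) both vanish. [ours; elementary] -/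
theorem envFun_eventuallyEq_aux_of_fract_eq_zero (hδ : 0 < δ) (ha : 0 < a) (hb : b ≤ 1) {y : ℝ}
    (hy : Int.fract y = 0) : envFun a b δ =ᶠ[𝓝 y] envAux a b δ (⌊y⌋ - 1) := by
  have hyn : y = ⌊y⌋ := by
    have h := hy; rw [Int.fract, sub_eq_zero] at h; exact h
  set n : ℤ := ⌊y⌋ with hn
  have hlo : (n : ℝ) - 1 < y := by rw [hyn]; linarith
  have hhi : y < (n : ℝ) + min a 1 := by rw [hyn]; linarith [lt_min ha one_pos]
  filter_upwards [Ioo_mem_nhds hlo hhi] with z hz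
  have hza : z < n + a := lt_of_lt_of_le hz.2 (by linarith [min_le_left a 1])
  have hz1 : z < n + 1 := lt_of_lt_of_le hz.2 (by linarith [min_le_right a 1])
  rcases lt_or_ge z (n : ℝ) with hzn | hzn
  · -- previous period: literally the representative
    have hfl : ⌊z⌋ = n - 1 := Int.floor_eq_iff.2 ⟨by push_cast; linarith [hz.1], by push_cast; linarith⟩
    have h := envFun_eq_aux (a := a) (b := b) (δ := δ) (y := z) (z := z) rfl
    rw [hfl] at h
    exact h
  · -- current period, `fract z = z - n < a`: both sides vanish
    have hfl : ⌊z⌋ = n := Int.floor_eq_iff.2 ⟨hzn, hz1⟩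
    have hfr : Int.fract z = z - n := by rw [Int.fract, hfl]
    have h1 : (Int.fract z - a) / δ ≤ 0 :=
      div_nonpos_of_nonpos_of_nonneg (by rw [hfr]; linarith) hδ.le
    have h2 : 1 ≤ (z - ((n - 1 : ℤ) : ℝ) - b + δ) / δ := by
      rw [le_div_iff₀ hδ]; push_cast; linarith
    simp only [envFun, envAux, Real.smoothTransition.zero_of_nonpos h1, Real.smoothTransition.one_of_one_le h2,
      zero_mul, sub_self, mul_zero]

/-- **The envelope is smooth** (`0 < δ`, `0 < a`, `b ≤ 1`). [ours; elementary] -/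
theorem contDiff_envFun (hδ : 0 < δ) (ha : 0 < a) (hb : b ≤ 1) : ContDiff ℝ ∞ (envFun a b δ) := by
  refine contDiff_iff_contDiffAt.2 fun y => ?_
  by_cases hy : Int.fract y = 0
  · exact (contDiff_envAux a b δ (⌊y⌋ - 1)).contDiffAt.congr_of_eventuallyEq
      (envFun_eventuallyEq_aux_of_fract_eq_zero hδ ha hb hy)
  · exact (contDiff_envAux a b δ ⌊y⌋).contDiffAt.congr_of_eventuallyEq (envFun_eventuallyEq_aux hy)

/-- **The plateau envelope `env a b δ` as a smooth `1`-periodic profile.** [ours; elementary] -/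
def env (a b : ℝ) (hδ : 0 < δ) (ha : 0 < a) (hb : b ≤ 1) : ShearProfile where
  toFun := envFun a b δ
  periodic' := envFun_periodic a b δ
  contDiff' := contDiff_envFun hδ ha hb

/-- Values of the envelope profile. [ours; bookkeeping] -/
@[simp]
theorem env_apply (hδ : 0 < δ) (ha : 0 < a) (hb : b ≤ 1) (y : ℝ) : env a b hδ ha hb y = envFun a b δ y := rfl

/-! ## 2. Values: range `[0,1]`, plateau, support -/

/-- `0 ≤ env ≤ 1`. [ours; elementary] -/
theorem envFun_mem_Icc (a b δ y : ℝ) : envFun a b δ y ∈ Icc (0 : ℝ) 1 := by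
  have ha0 := Real.smoothTransition.nonneg ((Int.fract y - a) / δ)
  have ha1 := Real.smoothTransition.le_one ((Int.fract y - a) / δ)
  have hb0 := Real.smoothTransition.nonneg ((Int.fract y - b + δ) / δ)
  have hb1 := Real.smoothTransition.le_one ((Int.fract y - b + δ) / δ)
  constructor
  · exact mul_nonneg ha0 (by linarith)
  · calc envFun a b δ y ≤ 1 * 1 := mul_le_mul ha1 (by linarith) (by linarith) zero_le_one
      _ = 1 := one_mul 1

/-- **Plateau: `env = 1` where `a + δ ≤ fract y ≤ b − δ`.** [ours; elementary] -/
theorem envFun_eq_one (hδ : 0 < δ) {y : ℝ} (hy1 : a + δ ≤ Int.fract y) (hy2 : Int.fract y ≤ b - δ) :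
    envFun a b δ y = 1 := by
  have h1 : Real.smoothTransition ((Int.fract y - a) / δ) = 1 :=
    Real.smoothTransition.one_of_one_le (by rw [le_div_iff₀ hδ]; linarith)
  have h2 : Real.smoothTransition ((Int.fract y - b + δ) / δ) = 0 :=
    Real.smoothTransition.zero_of_nonpos (div_nonpos_of_nonpos_of_nonneg (by linarith) hδ.le)
  rw [envFun, h1, h2]; norm_num

/-- **Support, left: `env = 0` where `fract y ≤ a`.** [ours; elementary] -/
theorem envFun_eq_zero_of_le (hδ : 0 < δ) {y : ℝ} (hy : Int.fract y ≤ a) : envFun a b δ y = 0 := by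
  have h1 : Real.smoothTransition ((Int.fract y - a) / δ) = 0 :=
    Real.smoothTransition.zero_of_nonpos (div_nonpos_of_nonpos_of_nonneg (by linarith) hδ.le)
  rw [envFun, h1, zero_mul]

/-- **Support, right: `env = 0` where `b ≤ fract y`.** [ours; elementary] -/
theorem envFun_eq_zero_of_ge (hδ : 0 < δ) {y : ℝ} (hy : b ≤ Int.fract y) : envFun a b δ y = 0 := by
  have h2 : Real.smoothTransition ((Int.fract y - b + δ) / δ) = 1 :=
    Real.smoothTransition.one_of_one_le (by rw [le_div_iff₀ hδ]; linarith)
  rw [envFun, h2]; norm_num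

/-- Where the envelope does not vanish, `a < fract y < b`. [ours; elementary] -/
theorem fract_mem_of_envFun_ne_zero (hδ : 0 < δ) {y : ℝ} (h : envFun a b δ y ≠ 0) :
    a < Int.fract y ∧ Int.fract y < b := by
  by_contra hc
  rw [not_and_or, not_lt, not_lt] at hc
  rcases hc with hc | hc
  · exact h (envFun_eq_zero_of_le hδ hc)
  · exact h (envFun_eq_zero_of_ge hδ hc)

/-- Real form of the support on `[0,1]`: `env = 0` on `[0, a]` and on `[b, 1]` (`0 ≤ a < 1`). [ours; elementary] -/
theorem envFun_eq_zero_of_mem (hδ : 0 < δ) (ha0 : 0 ≤ a) (ha1 : a < 1) {t : ℝ}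
    (ht : t ∈ Icc (0 : ℝ) a ∨ t ∈ Icc b 1) : envFun a b δ t = 0 := by
  rcases ht with h | h
  · have hf : Int.fract t = t := Int.fract_eq_self.2 ⟨h.1, by linarith [h.2]⟩
    exact envFun_eq_zero_of_le hδ (by rw [hf]; exact h.2)
  · rcases eq_or_lt_of_le h.2 with h1 | h1
    · rw [h1]
      refine envFun_eq_zero_of_le hδ ?_
      rw [Int.fract_one]; exact ha0
    · rcases lt_or_ge t 0 with h0 | h0
      · -- then `b ≤ t < 0 ≤ fract t`
        have hb0 : b < 0 := lt_of_le_of_lt h.1 h0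
        exact envFun_eq_zero_of_ge hδ (by linarith [Int.fract_nonneg t])
      · have hf : Int.fract t = t := Int.fract_eq_self.2 ⟨h0, h1⟩
        exact envFun_eq_zero_of_ge hδ (by rw [hf]; exact h.1)

/-! ## 3. Period integrals of powers: `b − a − 2δ ≤ ∫₀¹ envᵖ ≤ b − a` -/

/-- **Period integrals of powers of the envelope** (`p ≥ 1`, `0 < a`, `a + 2δ ≤ b ≤ 1`): the plateau has
length `b − a − 2δ`, the support length `b − a`. [ours; elementary] -/
theorem intervalIntegral_envFun_pow_mem (hδ : 0 < δ) (ha : 0 < a) (hab : a + 2 * δ ≤ b) (hb : b ≤ 1)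
    (p : ℕ) (hp : 1 ≤ p) :
    ∫ t in (0 : ℝ)..1, envFun a b δ t ^ p ∈ Icc (b - a - 2 * δ) (b - a) := by
  have hcont : Continuous fun t => envFun a b δ t ^ p := (contDiff_envFun hδ ha hb).continuous.pow p
  have hi : ∀ s t : ℝ, IntervalIntegrable (fun t => envFun a b δ t ^ p) volume s t := fun s t =>
    hcont.intervalIntegrable s t
  have hpw : ∀ t, envFun a b δ t ^ p ∈ Icc (0 : ℝ) 1 := fun t =>
    ⟨pow_nonneg (envFun_mem_Icc a b δ t).1 p,
      pow_le_one₀ (envFun_mem_Icc a b δ t).1 (envFun_mem_Icc a b δ t).2⟩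
  have ha1 : a < 1 := by linarith
  constructor
  · -- plateau
    have h1 : ∫ t in (a + δ)..(b - δ), envFun a b δ t ^ p = b - a - 2 * δ := by
      have : ∫ t in (a + δ)..(b - δ), envFun a b δ t ^ p = ∫ _t in (a + δ)..(b - δ), (1 : ℝ) := by
        refine intervalIntegral.integral_congr fun t ht => ?_
        rw [uIcc_of_le (by linarith)] at ht
        have hf : Int.fract t = t := Int.fract_eq_self.2 ⟨by linarith [ht.1], by linarith [ht.2]⟩
        rw [envFun_eq_one hδ (by rw [hf]; exact ht.1) (by rw [hf]; exact ht.2), one_pow]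
      rw [this, intervalIntegral.integral_const, smul_eq_mul, mul_one]; ring
    have h2 : ∫ t in (a + δ)..(b - δ), envFun a b δ t ^ p ≤ ∫ t in (0 : ℝ)..1, envFun a b δ t ^ p :=
      intervalIntegral.integral_mono_interval (by linarith) (by linarith) (by linarith)
        (Filter.Eventually.of_forall fun t => (hpw t).1) (hi 0 1)
    linarith
  · -- support
    have hsplit : ∫ t in (0 : ℝ)..1, envFun a b δ t ^ p =
        (∫ t in (0 : ℝ)..a, envFun a b δ t ^ p) + ((∫ t in a..b, envFun a b δ t ^ p) +
          ∫ t in b..(1 : ℝ), envFun a b δ t ^ p) := by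
      rw [intervalIntegral.integral_add_adjacent_intervals (hi _ _) (hi _ _),
        intervalIntegral.integral_add_adjacent_intervals (hi _ _) (hi _ _)]
    have hz1 : ∫ t in (0 : ℝ)..a, envFun a b δ t ^ p = 0 := by
      have : ∫ t in (0 : ℝ)..a, envFun a b δ t ^ p = ∫ _t in (0 : ℝ)..a, (0 : ℝ) := by
        refine intervalIntegral.integral_congr fun t ht => ?_
        rw [uIcc_of_le ha.le] at ht
        rw [envFun_eq_zero_of_mem hδ ha.le ha1 (Or.inl ht), zero_pow (by omega)]
      rw [this, intervalIntegral.integral_const, smul_eq_mul, mul_zero]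
    have hz2 : ∫ t in b..(1 : ℝ), envFun a b δ t ^ p = 0 := by
      have : ∫ t in b..(1 : ℝ), envFun a b δ t ^ p = ∫ _t in b..(1 : ℝ), (0 : ℝ) := by
        refine intervalIntegral.integral_congr fun t ht => ?_
        rw [uIcc_of_le hb] at ht
        rw [envFun_eq_zero_of_mem hδ ha.le ha1 (Or.inr ht), zero_pow (by omega)]
      rw [this, intervalIntegral.integral_const, smul_eq_mul, mul_zero]
    have hmid : ∫ t in a..b, envFun a b δ t ^ p ≤ ∫ _t in a..b, (1 : ℝ) :=
      intervalIntegral.integral_mono_on (by linarith) (hi _ _) intervalIntegrable_const fun t _ => (hpw t).2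
    rw [intervalIntegral.integral_const, smul_eq_mul, mul_one] at hmid
    rw [hsplit, hz1, hz2]
    linarith

/-- The envelope profile's period integrals (`ShearProfile` form). [ours; bookkeeping] -/
theorem intervalIntegral_env_pow_mem (hδ : 0 < δ) (ha : 0 < a) (hab : a + 2 * δ ≤ b) (hb : b ≤ 1)
    (p : ℕ) (hp : 1 ≤ p) :
    ∫ t in (0 : ℝ)..1, env a b hδ ha hb t ^ p ∈ Icc (b - a - 2 * δ) (b - a) :=
  intervalIntegral_envFun_pow_mem hδ ha hab hb p hp

/-- The envelope profile takes values in `[0,1]` on the circle. [ours; bookkeeping] -/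
theorem env_onCircle_mem_Icc (hδ : 0 < δ) (ha : 0 < a) (hb : b ≤ 1) (y : UnitAddCircle) :
    (env a b hδ ha hb).onCircle y ∈ Icc (0 : ℝ) 1 := by
  induction y using QuotientAddGroup.induction_on with
  | H t => rw [ShearProfile.onCircle_coe]; exact envFun_mem_Icc a b δ t

/-! ## 4. The two laminate envelopes `E₊ = env δ λ δ`, `E₋ = env (λ+δ) 1 δ` and their coupling with Lemma P -/

variable {lam : ℝ}

/-- Admissibility of `E₊ = env δ λ δ` and `E₋ = env (λ+δ) 1 δ` for `0 < δ`, `4δ ≤ λ`, `λ + 4δ ≤ 1`: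
`0 < δ`, `δ + 2δ ≤ λ ≤ 1`, `0 < λ + δ`, `(λ+δ) + 2δ ≤ 1 ≤ 1`. [ours; bookkeeping] -/
theorem env_admissible (hδ : 0 < δ) (h4 : 4 * δ ≤ lam) (h4' : lam + 4 * δ ≤ 1) :
    (δ + 2 * δ ≤ lam ∧ lam ≤ 1) ∧ (0 < lam + δ ∧ lam + δ + 2 * δ ≤ 1) :=
  ⟨⟨by linarith, by linarith⟩, ⟨by linarith, by linarith⟩⟩

/-- **Coupling `+`: where `E₊ = env δ λ δ` does not vanish, the step profile of Lemma P has slope EXACTLY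
`1 − λ`** (the `+` child's plateau). [ours; elementary] -/
theorem stepPrimD_eq_of_envPlus_ne_zero (hδ : 0 < δ) (hδl : δ ≤ lam) (h1 : lam + δ < 1) {y : ℝ}
    (h : envFun δ lam δ y ≠ 0) : (stepPrim hδ hδl h1).D y = 1 - lam := by
  obtain ⟨hlo, hhi⟩ := fract_mem_of_envFun_ne_zero hδ h
  exact stepPrimD_eq_of_plateauPlus hδ hδl h1 hlo.le hhi.le

/-- **Coupling `−`: where `E₋ = env (λ+δ) 1 δ` does not vanish, the step profile has slope EXACTLY `−λ`**
(the `−` child's plateau). [ours; elementary] -/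
theorem stepPrimD_eq_of_envMinus_ne_zero (hδ : 0 < δ) (hδl : δ ≤ lam) (h1 : lam + δ < 1) {y : ℝ}
    (h : envFun (lam + δ) 1 δ y ≠ 0) : (stepPrim hδ hδl h1).D y = -lam := by
  obtain ⟨hlo, -⟩ := fract_mem_of_envFun_ne_zero hδ h
  exact stepPrimD_eq_of_plateauMinus hδ hδl h1 hlo.le

/-- **Disjoint supports**: `E₊` and `E₋` never act at the same point. [ours; elementary] -/
theorem envPlus_mul_envMinus_eq_zero (hδ : 0 < δ) (y : ℝ) :
    envFun δ lam δ y * envFun (lam + δ) 1 δ y = 0 := by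
  by_cases h : envFun δ lam δ y = 0
  · rw [h, zero_mul]
  · obtain ⟨-, hhi⟩ := fract_mem_of_envFun_ne_zero hδ h
    rw [envFun_eq_zero_of_le hδ (a := lam + δ) (by linarith), mul_zero]

/-- On the circle: where `E₊` does not vanish, `Φ' = 1 − λ`. [ours; bookkeeping] -/
theorem stepPrimD_onCircle_eq_of_envPlus_ne_zero (hδ : 0 < δ) (hδl : δ ≤ lam) (h1 : lam + δ < 1)
    (hl1 : lam ≤ 1) {y : UnitAddCircle} (h : (env δ lam hδ hδ hl1).onCircle y ≠ 0) :
    (stepPrim hδ hδl h1).D.onCircle y = 1 - lam := by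
  induction y using QuotientAddGroup.induction_on with
  | H t =>
    rw [ShearProfile.onCircle_coe] at h ⊢
    exact stepPrimD_eq_of_envPlus_ne_zero hδ hδl h1 h

/-- On the circle: where `E₋` does not vanish, `Φ' = −λ`. [ours; bookkeeping] -/
theorem stepPrimD_onCircle_eq_of_envMinus_ne_zero (hδ : 0 < δ) (hδl : δ ≤ lam) (h1 : lam + δ < 1)
    (hl0 : 0 < lam + δ) {y : UnitAddCircle} (h : (env (lam + δ) 1 hδ hl0 le_rfl).onCircle y ≠ 0) :
    (stepPrim hδ hδl h1).D.onCircle y = -lam := by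
  induction y using QuotientAddGroup.induction_on with
  | H t =>
    rw [ShearProfile.onCircle_coe] at h ⊢
    exact stepPrimD_eq_of_envMinus_ne_zero hδ hδl h1 h

end Laminate

end Summit.NavierStokesRegularity.FunctionalMining

end
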